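import Summits.NavierStokesRegularity.NavierStokesRegularity.Theorems.ScenarioCensusRowD9CoreExponents
import HarnessLib

/-!
# Census row D9 TYPED — part 5/9: proof of the CORE, §6c (v) — the annulus and the assembly `CoreProof.steadyZoomDistance_proof`

Re-homed for the scenario census (typer seat ns-census-typer-1 g7; in scope of the census KEY text «one `def Row_<k> : Prop`
per OPEN row» — row D9 was the one OPEN-NO-LINE row without a typed tree decl, typer-1 g6 HANDOFF 19:50Z; lead programme ended
at v1.67, base SUMMON-only; ANNOUNCE on the cell STATUS 2026-08-28T20:24Z): VERBATIM PORT of ns-idea-9 LINE 16 «modulation_gate»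
rev 5, `pub/ideators/ns-idea-9/lines/modulation_gate/modulation_gate.lean` sha16 1d7b2cd493e504e0 (2259 l., lean check rc 0,
0 sorry; critic idea-crit-8 V66/V67/V69 PASS-WITH-PRICE on rev 1–4, ref ns-census-ref g8 PRE-CHECK ✓ §13.14 [5/6] of rev 4
f704279be2039922; rev 5 = rev 4 + §6e «S0 proved»; TARGET-MENU r4 names this line as row D9's lever; CENSUS-FINAL r6 §2 lists
`row_F4bp_of_row_D9K` / `row_F4bpLH_of_row_D9LH` as FILES-ONLY edges), split for the 400-line rule into
`ScenarioCensusRowD9Modulation` (§1–§4) → `…RowD9Kernel` (§5) → `…RowD9PowerLaw` (§6) → `…RowD9CoreExponents` (§6c (i)–(iv)) →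
`…RowD9Core` (§6c (v)) → `…RowD9DissipationTools` (§6d, first half) → `…RowD9Dissipation` (§6d, second half) →
`…RowD9SteadyLimitTools` (§6e, first half) → `…RowD9` (§6e, second half; §7; census KEYS).  Lean text VERBATIM in namespace
`…Theorems.ScenarioCensus.ModulationGate` (the line's `…Cruxes.Row_F4bp.ModulationGate` re-homed); port edits: the two
`local notation "E3"` lines → `abbrev E3` (typer lint: no notation in port files), `@[conjecture]` added to the four OPEN
parameterless `def`s `Row_D9K` / `Row_D9LH` / `Row_D9LHWild` / `Row_F4bpLH` (obligation nodes), one-line docstrings added to twelve undocumented auxiliaries, the three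
`@[deprecated] stub_*` aliases of §7 not re-declared, four §7 docstrings updated to the rev-5 facts (everything proved).

No census value is asserted here (a summoned lead books row D9; FILES-ONLY edges become TREE by name); NS regularity is NOT
proved; rows D9 / F4b′ stay OPEN (= their wild residuals, by theorem); no summit statement is proved by this file.
-/

-- the summit and its single problem share the name `NavierStokesRegularity` (D-0017 nested layout)
set_option linter.dupNamespace false

noncomputable section

open Set Function Filter Topology MeasureTheory Metric
open scoped NNReal ENNReal ContDiff

namespace Summit.NavierStokesRegularity.NavierStokesRegularity.Theorems.ScenarioCensus.ModulationGate

open Literature.Analysis Literature.Analysis.FluidPDE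
open Summit.NavierStokesRegularity.NavierStokesRegularity.Theorems.ScenarioCensus

namespace CoreProof

/-! ### (v) the annulus and the assembly -/

/-- `|{R < |x| < 2R}| ≤ (2R)³ |B₁|`. -/
theorem volume_annulus_le {R : ℝ} (hR : 0 < R) :
    volume {x : EuclideanSpace ℝ (Fin 3) | R < ‖x‖ ∧ ‖x‖ < 2 * R} ≤
      ENNReal.ofReal ((2 * R) ^ 3 * (volume (ball (0 : EuclideanSpace ℝ (Fin 3)) 1)).toReal) := by
  have hsub : {x : EuclideanSpace ℝ (Fin 3) | R < ‖x‖ ∧ ‖x‖ < 2 * R} ⊆ ball 0 (2 * R) := by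
    intro x hx; rw [mem_ball_zero_iff]; exact hx.2
  calc volume {x : EuclideanSpace ℝ (Fin 3) | R < ‖x‖ ∧ ‖x‖ < 2 * R}
      ≤ volume (ball (0 : EuclideanSpace ℝ (Fin 3)) (2 * R)) := measure_mono hsub
    _ = ENNReal.ofReal ((2 * R) ^ 3) * volume (ball (0 : EuclideanSpace ℝ (Fin 3)) 1) := by
        rw [Measure.addHaar_ball_of_pos volume _ (by positivity), finrank_euclideanSpace_fin]
    _ = ENNReal.ofReal ((2 * R) ^ 3 * (volume (ball (0 : EuclideanSpace ℝ (Fin 3)) 1)).toReal) := by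
        rw [ENNReal.ofReal_mul (by positivity), ENNReal.ofReal_toReal measure_ball_lt_top.ne]

/-- `((2R)³ v)^{1/2 − 1/p} = (8v)^{1/2 − 1/p} R^b`. -/
theorem annulus_const {p : ℝ} (hp : 0 < p) {R v : ℝ} (hR : 0 < R) (hv : 0 < v) :
    ((2 * R) ^ 3 * v) ^ (1 / 2 - 1 / p) = (8 * v) ^ (1 / 2 - 1 / p) * R ^ coreB p := by
  rw [show (2 * R) ^ 3 * v = (8 * v) * R ^ 3 by ring, Real.mul_rpow (by positivity) (by positivity),
    ← Real.rpow_natCast R 3, ← Real.rpow_mul hR.le]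
  have h3 : ((3 : ℕ) : ℝ) * (1 / 2 - 1 / p) = coreB p := by
    unfold coreB; push_cast
    field_simp
  rw [h3]

/-- **THE CORE, PROVED** (rev 3): `SteadyZoomDistance` holds — for a NONZERO smooth steady solution
`U ∈ L^p` (`p > 3`) and test fields `w` with `‖w‖₂ ≤ M`, `λ^{−3/(2p)}‖w − λU(λ·)‖_p ≥ c(U,p,M) > 0` for all
large `λ`.  Ingredients: Tsai 2021 Thm 1.1 (a) at `δ = 0` (tree theorem `Tsai2021_annular_liouville_holds`,
contrapositive `liminf R⁻¹∫_{A_R}|U|³ > 0`), Hölder `|U|³ = |U|^α|U|^{3−α}` on the annulus, the exact `L^q`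
scaling of the zoom, Hölder `L^p(A_R) → L²(A_R)`, and the choice `R^a ∼ λ^{1/2}` (`core_algebra`). -/
theorem steadyZoomDistance_proof : SteadyZoomDistance := by
  intro U V P hUP hVU p hp3 hV hU M hM
  have hp3r : (3 : ℝ) < (p : ℝ) := by exact_mod_cast hp3
  have hp0r : (0 : ℝ) < (p : ℝ) := by linarith
  have hp0 : (p : ℝ≥0∞) ≠ 0 := by
    have : (p : ℝ≥0) ≠ 0 := by intro h; rw [h] at hp3; exact absurd hp3 (by norm_num)
    exact_mod_cast this
  have hp2 : (2 : ℝ≥0∞) ≤ (p : ℝ≥0∞) := by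
    have : (2 : ℝ≥0) ≤ p := le_of_lt (lt_trans (by norm_num) hp3)
    exact_mod_cast this
  have hUc : Continuous U := hUP.smooth_velocity.continuous
  have hUm : AEStronglyMeasurable U volume := hUc.aestronglyMeasurable
  have hVm : AEStronglyMeasurable V volume := hV.aestronglyMeasurable
  have hUpV : eLpNorm U (p : ℝ≥0∞) volume = eLpNorm V (p : ℝ≥0∞) volume :=
    eLpNorm_congr_ae hVU.symm
  have hNtop : eLpNorm U (p : ℝ≥0∞) volume ≠ ⊤ := by rw [hUpV]; exact hV.eLpNorm_ne_top
  have hN : 0 < (eLpNorm U (p : ℝ≥0∞) volume).toReal := by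
    refine ENNReal.toReal_pos (fun h0 => hU ?_) hNtop
    have hae := (eLpNorm_eq_zero_iff hUm hp0).1 h0
    exact (hUc.ae_eq_iff_eq (μ := volume) continuous_zero).1 hae
  -- Tsai 2021 Thm 1.1 (a), δ = 0, L = 2: a nonzero steady solution has liminf R⁻¹∫_{A_R}|U|³ ≠ 0
  have hprof : IsLerayProfile 1 0 U P := hUP.isLerayProfile_zero
  have hlim : liminf (tsaiAnnulusQuantity 0 2 U) atTop ≠ 0 :=
    Tsai2021_annular_liouville_holds.liminf_ne_zero one_pos hprof hU le_rfl zero_le_one one_lt_two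
  set ℓ := liminf (tsaiAnnulusQuantity 0 2 U) atTop with hℓ
  have hmin0 : min ℓ 1 ≠ 0 := (lt_min (pos_iff_ne_zero.2 hlim) one_pos).ne'
  have hmintop : min ℓ 1 ≠ ⊤ := ne_top_of_le_ne_top ENNReal.one_ne_top (min_le_right _ _)
  set ε₀ : ℝ≥0∞ := min ℓ 1 / 2 with hε₀
  have hε₀0 : ε₀ ≠ 0 := (ENNReal.div_pos hmin0 ENNReal.ofNat_ne_top).ne'
  have hε₀top : ε₀ ≠ ⊤ := ne_top_of_le_ne_top hmintop ENNReal.half_le_self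
  have hε₀lt : ε₀ < ℓ := lt_of_lt_of_le (ENNReal.half_lt_self hmin0 hmintop) (min_le_left _ _)
  have hev : ∀ᶠ R in atTop, ε₀ < tsaiAnnulusQuantity 0 2 U R := eventually_lt_of_lt_liminf hε₀lt
  obtain ⟨R₀, hR₀⟩ := (hev.and (eventually_gt_atTop 0)).exists_forall_of_atTop
  -- the real constants
  have hε : 0 < ε₀.toReal := ENNReal.toReal_pos hε₀0 hε₀top
  have hE : 0 < max M.toReal 1 := lt_of_lt_of_le one_pos (le_max_right _ _)
  have hv₁ : 0 < (volume (ball (0 : EuclideanSpace ℝ (Fin 3)) 1)).toReal :=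
    ENNReal.toReal_pos (measure_ball_pos volume 0 one_pos).ne' measure_ball_lt_top.ne
  set ε := ε₀.toReal with hεdef
  set N := (eLpNorm U (p : ℝ≥0∞) volume).toReal with hNdef
  set E := max M.toReal 1 with hEdef
  set v₁ := (volume (ball (0 : EuclideanSpace ℝ (Fin 3)) 1)).toReal with hv₁def
  set κ₃ : ℝ := (8 * v₁) ^ (1 / 2 - 1 / (p : ℝ)) with hκ₃def
  have hκ₃ : 0 < κ₃ := Real.rpow_pos_of_pos (by positivity) _
  have hκ₂ := coreKappa2_pos (p := (p : ℝ)) hε hN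
  have ha := coreA_pos hp3r
  refine ⟨ENNReal.ofReal (coreConst p ε N E κ₃),
    (ENNReal.ofReal_pos.2 (coreConst_pos hε hN hE hκ₃)).ne', ?_⟩
  -- the annulus radius as a function of the scale: R(L)^a = 2 L^{1/2} E / κ₂, R(L) → ∞
  have hRt : Tendsto (fun L : ℝ => (2 * L ^ (1 / 2 : ℝ) * E / coreKappa2 p ε N) ^ (1 / coreA p))
      atTop atTop := by
    have h : Tendsto ((fun x : ℝ => x ^ (1 / coreA p)) ∘
        (fun L : ℝ => 2 * L ^ (1 / 2 : ℝ) * E / coreKappa2 p ε N)) atTop atTop := by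
      refine (tendsto_rpow_atTop (by positivity)).comp ?_
      refine Tendsto.atTop_div_const hκ₂ (Tendsto.atTop_mul_const hE ?_)
      exact Tendsto.const_mul_atTop two_pos (tendsto_rpow_atTop (by norm_num))
    exact h
  filter_upwards [hRt.eventually_ge_atTop R₀, eventually_gt_atTop (0 : ℝ)] with L hLR hL w hw hwM
  set R : ℝ := (2 * L ^ (1 / 2 : ℝ) * E / coreKappa2 p ε N) ^ (1 / coreA p) with hRdef
  obtain ⟨hTsai, hR0⟩ := hR₀ R hLR
  have hR3 : R ^ coreA p = 2 * L ^ (1 / 2 : ℝ) * E / coreKappa2 p ε N := by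
    rw [hRdef, one_div (coreA p), Real.rpow_inv_rpow (by positivity) ha.ne']
  set r : EuclideanSpace ℝ (Fin 3) → EuclideanSpace ℝ (Fin 3) := fun x => w x - L • V (L • x)
    with hrdef
  have hLpow : 0 < L ^ (-(3 / (2 * (p : ℝ)))) := Real.rpow_pos_of_pos hL _
  by_cases hrtop : eLpNorm r (p : ℝ≥0∞) volume = ⊤
  · rw [hrtop, ENNReal.mul_top (ENNReal.ofReal_pos.2 hLpow).ne']
    exact le_top
  set ρ := (eLpNorm r (p : ℝ≥0∞) volume).toReal with hρdef
  have hρ : 0 ≤ ρ := ENNReal.toReal_nonneg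
  have hrρ : eLpNorm r (p : ℝ≥0∞) volume = ENNReal.ofReal ρ := (ENNReal.ofReal_toReal hrtop).symm
  set A : Set (EuclideanSpace ℝ (Fin 3)) := {x | R < ‖x‖ ∧ ‖x‖ < 2 * R} with hAdef
  -- (h2) energy transported under the zoom, on the annulus
  have hUA : eLpNorm U 2 (volume.restrict A) = eLpNorm V 2 (volume.restrict A) :=
    eLpNorm_congr_ae (ae_restrict_of_ae hVU.symm)
  have hX_le : eLpNorm U 2 (volume.restrict A) ≤
      ENNReal.ofReal (L ^ (1 / 2 : ℝ) * E + κ₃ * R ^ coreB p * L ^ (3 / (p : ℝ) - 1) * ρ) := by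
    rw [hUA]
    refine (energy_transport hp2 hw hVm hL A).trans ?_
    have h1 : ENNReal.ofReal (L ^ (1 / 2 : ℝ)) * eLpNorm w 2 volume ≤
        ENNReal.ofReal (L ^ (1 / 2 : ℝ) * E) := by
      rw [ENNReal.ofReal_mul (by positivity)]
      gcongr
      calc eLpNorm w 2 volume ≤ M := hwM
        _ = ENNReal.ofReal M.toReal := (ENNReal.ofReal_toReal hM).symm
        _ ≤ ENNReal.ofReal E := ENNReal.ofReal_le_ofReal (le_max_left _ _)
    have hvolA : volume A ^ (1 / 2 - 1 / (p : ℝ)) ≤ ENNReal.ofReal (κ₃ * R ^ coreB p) := by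
      have he : 0 ≤ 1 / 2 - 1 / (p : ℝ) := by
        rw [sub_nonneg, one_div_le_one_div hp0r (by norm_num)]; linarith
      calc volume A ^ (1 / 2 - 1 / (p : ℝ))
          ≤ ENNReal.ofReal ((2 * R) ^ 3 * v₁) ^ (1 / 2 - 1 / (p : ℝ)) :=
            ENNReal.rpow_le_rpow (volume_annulus_le hR0) he
        _ = ENNReal.ofReal (((2 * R) ^ 3 * v₁) ^ (1 / 2 - 1 / (p : ℝ))) :=
            ENNReal.ofReal_rpow_of_nonneg (by positivity) he
        _ = ENNReal.ofReal (κ₃ * R ^ coreB p) := by rw [annulus_const hp0r hR0 hv₁]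
    have h2 : volume A ^ (1 / 2 - 1 / (p : ℝ)) *
        (ENNReal.ofReal (L ^ (3 / (p : ℝ) - 1)) * eLpNorm r (p : ℝ≥0∞) volume) ≤
        ENNReal.ofReal (κ₃ * R ^ coreB p * L ^ (3 / (p : ℝ) - 1) * ρ) := by
      rw [hrρ, ← ENNReal.ofReal_mul (by positivity), mul_assoc (κ₃ * R ^ coreB p),
        ENNReal.ofReal_mul (by positivity : (0:ℝ) ≤ κ₃ * R ^ coreB p)]
      gcongr
    calc _ ≤ ENNReal.ofReal (L ^ (1 / 2 : ℝ) * E) +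
          ENNReal.ofReal (κ₃ * R ^ coreB p * L ^ (3 / (p : ℝ) - 1) * ρ) := add_le_add h1 h2
      _ = _ := (ENNReal.ofReal_add (by positivity) (by positivity)).symm
  have hXtop : eLpNorm U 2 (volume.restrict A) ≠ ⊤ := ne_top_of_le_ne_top ENNReal.ofReal_ne_top hX_le
  set X := (eLpNorm U 2 (volume.restrict A)).toReal with hXdef
  have hX0 : 0 ≤ X := ENNReal.toReal_nonneg
  have h2r : X ≤ L ^ (1 / 2 : ℝ) * E + κ₃ * R ^ coreB p * L ^ (3 / (p : ℝ) - 1) * ρ :=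
    ENNReal.toReal_le_of_le_ofReal (by positivity) hX_le
  -- (h1) Tsai + Hölder on the annulus
  have hR0e : ENNReal.ofReal R ≠ 0 := (ENNReal.ofReal_pos.2 hR0).ne'
  have hI : ε₀ * ENNReal.ofReal R ≤ ∫⁻ x in A, ‖U x‖ₑ ^ (3 : ℝ) := by
    rw [tsaiAnnulusQuantity_zero_two] at hTsai
    calc ε₀ * ENNReal.ofReal R
        ≤ ((ENNReal.ofReal R)⁻¹ * ∫⁻ x in A, ‖U x‖ₑ ^ (3 : ℝ)) * ENNReal.ofReal R :=
          mul_le_mul_left hTsai.le _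
      _ = ∫⁻ x in A, ‖U x‖ₑ ^ (3 : ℝ) := by
          rw [mul_comm (ENNReal.ofReal R)⁻¹, mul_assoc,
            ENNReal.inv_mul_cancel hR0e ENNReal.ofReal_ne_top, mul_one]
  have hH := lintegral_cube_le hp3r hUm A
  have hfin : eLpNorm U 2 (volume.restrict A) ^ coreAlpha p *
      eLpNorm U (p : ℝ≥0∞) volume ^ (3 - coreAlpha p) ≠ ⊤ :=
    ENNReal.mul_ne_top (ENNReal.rpow_ne_top_of_nonneg (coreAlpha_pos hp3r).le hXtop)
      (ENNReal.rpow_ne_top_of_nonneg (by linarith [coreAlpha_lt_two hp3r]) hNtop)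
  have h1r : ε * R ≤ X ^ coreAlpha p * N ^ (3 - coreAlpha p) := by
    have := ENNReal.toReal_mono hfin (hI.trans hH)
    rw [ENNReal.toReal_mul, ENNReal.toReal_ofReal hR0.le, ENNReal.toReal_mul,
      ← ENNReal.toReal_rpow, ← ENNReal.toReal_rpow] at this
    exact this
  -- conclude with the pure-real optimisation
  have key := core_algebra hp3r hL hE hX0 hρ hN hε hκ₃ hR0 h1r h2r hR3
  rw [hrρ, ← ENNReal.ofReal_mul hLpow.le]
  exact ENNReal.ofReal_le_ofReal key

end CoreProof

end Summit.NavierStokesRegularity.NavierStokesRegularity.Theorems.ScenarioCensus.ModulationGate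

end
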